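import Literature.Probability.RandomPlanarGeometry.ChordalCurveFamilyProofs
import Mathlib.Topology.MetricSpace.Thickening
import HarnessLib

/-!
# `LagHandOff` (stmt-CriticalPhenomena-10268), line `crosscut-dictionary`, STUBS 6–7: the
# stopping map `stopAt F` is DIScontinuous at one-sided touching

Negative lemma of the standing adversary (refuter `cdisprove`, cycle 4) for the provers of
`stub_freeAxioms` (LSW locality `IsLocal`, target independence `IsTargetIndependent`) and
`stub_markovPassage` of crux `LagHandOff`.  Their plan (skeleton `Lines/crosscut-dictionary.lean`,
docstrings of STUBS 6–7; `Theorems/CardySelfRefinementLagHandOffChordal.lean`, module docstring)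
passes EXACT lattice identities for stopped interfaces to the limit by "a.s. continuity of
`CurveClass.stopAt` at the limit law".  That step is NOT available where it is needed:

* `not_continuousAt_mk_stopAt` — if a curve `γ` first meets the closed set `F` at a point
  different from its endpoint while `γ` is a limit of curves AVOIDING `F`, then
  `c ↦ [c.stopAt F]` is discontinuous at `γ` (along the approximants the map is the identity, so
  its values tend to `[γ]`, whose endpoint is not the endpoint `γ(σ_F)` of `[γ.stopAt F]`);
  `not_continuousAt_curveClass_stopAt` — the same for `CurveClass.stopAt F` at `[γ]`.
* `exists_not_continuousAt_stopAt` — the hypotheses are met (closed half-plane `{im ≥ 1}`, the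
  parabolic arch of height `1` touching it at its apex, approximated by lower arches).
* `not_continuousAt_mk_stopAt_of_subset_sphere` — the form that bites the tree's `unitDisc`: for
  ANY `F ⊆ ∂𝔻` (e.g. a boundary arc of a marking of the disc) and any curve in the closed disc whose
  first contact with `F` is not its endpoint, radial shrinking gives `F`-avoiding approximants in
  the open disc, so `c ↦ [c.stopAt F]` is discontinuous there.
* `tendsto_hitParam_cthickening` — the REPAIR is available: for closed `F` and every curve the
  first-hitting parameter of `cthickening ε F` tends to that of `F` as `ε → 0` (deterministic).

Why this is the relevant situation.  In `IsTargetIndependent` the stopping set is the boundary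
arc `F = D.arc 1 ⊆ ∂D` (empty interior): the lattice interfaces are polylines through medial
points of edges of `Ω_δ ⊆ D` and avoid `∂D` (up to non-convexity accidents), while the limit
curve, ending at `b ∈ D.arc 1`, touches `D.arc 1` before reaching `b` with positive probability
(boundary touching of SLE₆-type curves, `κ = 6 > 4`) — one-sidedly, from inside `D̄`.  On the
`D'`-side of `IsLocal` the stopping set `F = closure (D ∖ D')` meets `D̄'` only inside `∂D'`, the
`D'`-interfaces live in `D'` and avoid it, and the limit `D'`-curve touches `∂D' ∩ D` with positive
probability.  In both cases the stopped LATTICE curves converge to the UNSTOPPED limit curve, not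
to the stopped one, on an event of positive probability.  Repairs available to the prover: stop at
the closed thickenings `cthickening ε F` (fat sets, entered immediately after being touched, for
which continuity at the limit law is plausible) and let `ε ↓ 0` — for every curve the first
hitting parameter of `cthickening ε F` increases to that of `F` —, or carry the lattice COUPLING
of the two explorations (they coincide up to the first boundary step where the data differ) to
the limit as a coupling.
-/

noncomputable section

open Set Filter Topology

namespace Summit.CriticalPhenomena.CardyFormulaZ2.Theorems.LagHandOff.Negative

open Literature.Probability.RandomPlanarGeometry

/-- `CurveClass.mk` is continuous (it is the separation-quotient map). [folklore] -/
theorem continuous_curveClassMk {E : Type*} [PseudoMetricSpace E] :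
    Continuous (CurveClass.mk : Curve E → CurveClass E) := by
  rw [CurveClass.mk_eq_separationQuotientMk]
  exact SeparationQuotient.continuous_mk

/-- **OBSTRUCTION (generic).**  If a curve `γ` meets the set `F` with first contact point
`γ(σ_F)` different from its endpoint `γ(1)`, while `γ` is a limit (reparametrisation distance) of
curves AVOIDING `F`, then the stopping map `c ↦ [c.stopAt F]` is NOT continuous at `γ`. [folklore] -/
theorem not_continuousAt_mk_stopAt {E : Type*} [MetricSpace E] {F : Set E} {γ : Curve E}
    {γs : ℕ → Curve E} (hconv : Tendsto γs atTop (𝓝 γ)) (havoid : ∀ n t, γs n t ∉ F)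
    (hne : γ ⟨γ.hitParam F, γ.hitParam_mem_Icc F⟩ ≠ γ.target) :
    ¬ ContinuousAt (fun c : Curve E => CurveClass.mk (c.stopAt F)) γ := by
  intro hcont
  -- along the approximants the stopping map is the identity
  have hid : ∀ n, (γs n).stopAt F = γs n := fun n =>
    Curve.stopAt_eq_self_of_hitParam_eq_one (Curve.hitParam_eq_one_of_forall_notMem (havoid n))
  have h1 : Tendsto (fun n => CurveClass.mk ((γs n).stopAt F)) atTop
      (𝓝 (CurveClass.mk (γ.stopAt F))) := hcont.tendsto.comp hconv
  have h2 : Tendsto (fun n => CurveClass.mk ((γs n).stopAt F)) atTop (𝓝 (CurveClass.mk γ)) := by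
    simp only [hid]
    exact (continuous_curveClassMk.tendsto γ).comp hconv
  have heq : CurveClass.mk (γ.stopAt F) = CurveClass.mk γ := tendsto_nhds_unique h1 h2
  have htgt := congrArg CurveClass.target heq
  rw [CurveClass.target_mk, CurveClass.target_mk, Curve.target_stopAt] at htgt
  exact hne htgt

/-- **OBSTRUCTION on curve classes**: under the same hypotheses, for closed `F`,
`CurveClass.stopAt F` is not continuous at `[γ]` (`CurveClass.stopAt F ∘ mk = mk ∘ Curve.stopAt F`
by the discharged named fact `CurveClass.stopAt_mk_holds`). [folklore] -/
theorem not_continuousAt_curveClass_stopAt {E : Type*} [MetricSpace E] {F : Set E}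
    (hF : IsClosed F) {γ : Curve E} {γs : ℕ → Curve E} (hconv : Tendsto γs atTop (𝓝 γ))
    (havoid : ∀ n t, γs n t ∉ F)
    (hne : γ ⟨γ.hitParam F, γ.hitParam_mem_Icc F⟩ ≠ γ.target) :
    ¬ ContinuousAt (CurveClass.stopAt F) (CurveClass.mk γ) := by
  intro hcont
  apply not_continuousAt_mk_stopAt hconv havoid hne
  have hfun : (fun c : Curve E => CurveClass.mk (c.stopAt F)) =
      CurveClass.stopAt F ∘ CurveClass.mk := by
    funext c
    exact (CurveClass.stopAt_mk_holds F hF c).symm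
  rw [hfun]
  exact hcont.comp continuous_curveClassMk.continuousAt

/-- `4 x (1 - x) ≤ 1`. [folklore] -/
theorem four_mul_mul_one_sub_le_one (x : ℝ) : 4 * x * (1 - x) ≤ 1 := by
  nlinarith [sq_nonneg (2 * x - 1)]

/-- `0 ≤ 4 x (1 - x)` on `[0, 1]`. [folklore] -/
theorem four_mul_mul_one_sub_nonneg {x : ℝ} (h0 : 0 ≤ x) (h1 : x ≤ 1) :
    0 ≤ 4 * x * (1 - x) := by
  have : 0 ≤ 1 - x := sub_nonneg.2 h1
  positivity

/-- **The obstruction is real.**  For the closed half-plane `F = {im ≥ 1}` and the parabolic arch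
`γ : t ↦ i · 4t(1-t)` of height `1` (touching `F` at its apex `i`, returning to `0`), approximated
by the lower arches `t ↦ i · 4 r t (1-t)`, `r ↑ 1` (which avoid `F`), BOTH stopping maps are
discontinuous: `c ↦ [c.stopAt F]` at `γ` and `CurveClass.stopAt F` at `[γ]`. [folklore] -/
theorem exists_not_continuousAt_stopAt :
    ∃ F : Set ℂ, IsClosed F ∧ ∃ γ : Curve ℂ,
      ¬ ContinuousAt (fun c : Curve ℂ => CurveClass.mk (c.stopAt F)) γ ∧
      ¬ ContinuousAt (CurveClass.stopAt F) (CurveClass.mk γ) := by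
  set F : Set ℂ := {z : ℂ | 1 ≤ z.im} with hF
  have hFc : IsClosed F := isClosed_le continuous_const Complex.continuous_im
  -- the arches
  let arch : ℝ → Curve ℂ := fun r =>
    ⟨⟨fun t : unitInterval => ((r * (4 * (t : ℝ) * (1 - t)) : ℝ) : ℂ) * Complex.I,
      ((Complex.continuous_ofReal.comp (by fun_prop)).mul continuous_const)⟩⟩
  have arch_apply : ∀ (r : ℝ) (t : unitInterval),
      arch r t = ((r * (4 * (t : ℝ) * (1 - t)) : ℝ) : ℂ) * Complex.I := fun r t => rfl
  have arch_im : ∀ (r : ℝ) (t : unitInterval), (arch r t).im = r * (4 * (t : ℝ) * (1 - t)) := by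
    intro r t; simp [arch_apply]
  have dist_arch_le : ∀ r : ℝ, dist (arch r) (arch 1) ≤ |r - 1| := by
    intro r
    refine (Curve.dist_le_dist_toContinuousMap _ _).trans ?_
    refine (ContinuousMap.dist_le (abs_nonneg _)).2 fun t => ?_
    change dist (arch r t) (arch 1 t) ≤ |r - 1|
    rw [arch_apply, arch_apply, dist_eq_norm, ← sub_mul, norm_mul, Complex.norm_I, mul_one,
      ← Complex.ofReal_sub, Complex.norm_real, Real.norm_eq_abs,
      show r * (4 * (t : ℝ) * (1 - t)) - 1 * (4 * (t : ℝ) * (1 - t)) =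
        (r - 1) * (4 * (t : ℝ) * (1 - t)) by ring, abs_mul,
      abs_of_nonneg (four_mul_mul_one_sub_nonneg t.2.1 t.2.2)]
    exact mul_le_of_le_one_right (abs_nonneg _) (four_mul_mul_one_sub_le_one _)
  -- the three hypotheses of the generic obstruction, for `γ = arch 1`, `γs n = arch (1 - 1/(n+2))`
  have hconv : Tendsto (fun n : ℕ => arch (1 - 1 / ((n : ℝ) + 2))) atTop (𝓝 (arch 1)) := by
    rw [tendsto_iff_dist_tendsto_zero]
    have h0 : Tendsto (fun n : ℕ => 1 / ((n : ℝ) + 2)) atTop (𝓝 0) := by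
      have := (tendsto_one_div_add_atTop_nhds_zero_nat (𝕜 := ℝ)).comp (tendsto_add_atTop_nat 1)
      refine this.congr fun n => ?_
      simp only [Function.comp_apply, Nat.cast_add, Nat.cast_one]
      ring
    refine squeeze_zero (fun n => dist_nonneg) (fun n => ?_) h0
    refine (dist_arch_le _).trans (le_of_eq ?_)
    rw [show (1 : ℝ) - 1 / ((n : ℝ) + 2) - 1 = -(1 / ((n : ℝ) + 2)) by ring, abs_neg,
      abs_of_nonneg (by positivity)]
  have havoid : ∀ (n : ℕ) (t : unitInterval), arch (1 - 1 / ((n : ℝ) + 2)) t ∉ F := by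
    intro n t ht
    change 1 ≤ (arch (1 - 1 / ((n : ℝ) + 2)) t).im at ht
    rw [arch_im] at ht
    have hlt : (1 - 1 / ((n : ℝ) + 2)) * (4 * (t : ℝ) * (1 - t)) < 1 := by
      have h4 := four_mul_mul_one_sub_le_one (t : ℝ)
      have hpos : 0 < 1 / ((n : ℝ) + 2) := by positivity
      have hp1 : 1 / ((n : ℝ) + 2) ≤ 1 := by
        rw [div_le_one (by positivity)]
        linarith [n.cast_nonneg (α := ℝ)]
      have hmul : (1 - 1 / ((n : ℝ) + 2)) * (4 * (t : ℝ) * (1 - t)) ≤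
          (1 - 1 / ((n : ℝ) + 2)) * 1 := mul_le_mul_of_nonneg_left h4 (by linarith)
      linarith
    exact absurd ht (not_le.2 hlt)
  have hne : arch 1 ⟨(arch 1).hitParam F, (arch 1).hitParam_mem_Icc F⟩ ≠ (arch 1).target := by
    -- first contact point has `im = 1`, the endpoint has `im = 0`
    have hmem : arch 1 ⟨(arch 1).hitParam F, (arch 1).hitParam_mem_Icc F⟩ ∈ F := by
      refine Curve.apply_hitParam_mem hFc ⟨⟨1 / 2, by norm_num, by norm_num⟩, ?_⟩
      change 1 ≤ (arch 1 _).im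
      rw [arch_im]
      norm_num
    intro h
    rw [h] at hmem
    change 1 ≤ ((arch 1).target).im at hmem
    rw [Curve.target_def, arch_im] at hmem
    norm_num at hmem
  exact ⟨F, hFc, arch 1, not_continuousAt_mk_stopAt hconv havoid hne,
    not_continuousAt_curveClass_stopAt hFc hconv havoid hne⟩

/-! ### Unit-disc form of the obstruction, and the thickening repair (cycle 4, second pass) -/

/-- **OBSTRUCTION, unit-disc form (the functional of `IsTargetIndependent` / `IsLocal` at the
tree's `unitDisc`).**  Let `F` be ANY subset of the unit circle (e.g. a boundary arc `D.arc 1` of a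
marking of the unit disc) and `γ` a curve in the CLOSED unit disc whose first contact with `F` is
not its endpoint.  Then `c ↦ [c.stopAt F]` is discontinuous at `γ`: the radially shrunk curves
`(1 - 1/(n+2)) • γ` lie in the OPEN disc (as lattice interfaces do), avoid `F`, and converge to
`γ`. [folklore] -/
theorem not_continuousAt_mk_stopAt_of_subset_sphere {F : Set ℂ} (hF : F ⊆ Metric.sphere (0 : ℂ) 1)
    {γ : Curve ℂ} (hγ : ∀ t, ‖γ t‖ ≤ 1)
    (hne : γ ⟨γ.hitParam F, γ.hitParam_mem_Icc F⟩ ≠ γ.target) :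
    ¬ ContinuousAt (fun c : Curve ℂ => CurveClass.mk (c.stopAt F)) γ := by
  -- radial shrinking
  let shrink : ℝ → Curve ℂ := fun r => ⟨⟨fun t => (r : ℂ) * γ t,
    continuous_const.mul γ.continuous⟩⟩
  have shrink_apply : ∀ (r : ℝ) (t : unitInterval), shrink r t = (r : ℂ) * γ t := fun r t => rfl
  refine not_continuousAt_mk_stopAt (γs := fun n : ℕ => shrink (1 - 1 / ((n : ℝ) + 2))) ?_ ?_ hne
  · -- convergence: `dist (r • γ) γ ≤ |r - 1|`
    rw [tendsto_iff_dist_tendsto_zero]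
    have h0 : Tendsto (fun n : ℕ => 1 / ((n : ℝ) + 2)) atTop (𝓝 0) := by
      have := (tendsto_one_div_add_atTop_nhds_zero_nat (𝕜 := ℝ)).comp (tendsto_add_atTop_nat 1)
      refine this.congr fun n => ?_
      simp only [Function.comp_apply, Nat.cast_add, Nat.cast_one]
      ring
    refine squeeze_zero (fun n => dist_nonneg) (fun n => ?_) h0
    refine (Curve.dist_le_dist_toContinuousMap _ _).trans ?_
    refine (ContinuousMap.dist_le (by positivity)).2 fun t => ?_
    change dist (shrink (1 - 1 / ((n : ℝ) + 2)) t) (γ t) ≤ 1 / ((n : ℝ) + 2)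
    rw [shrink_apply, dist_eq_norm,
      show ((1 - 1 / ((n : ℝ) + 2) : ℝ) : ℂ) * γ t - γ t = -(((1 / ((n : ℝ) + 2) : ℝ) : ℂ) * γ t) by
        push_cast; ring,
      norm_neg, norm_mul, Complex.norm_real, Real.norm_eq_abs, abs_of_nonneg (by positivity)]
    exact mul_le_of_le_one_right (by positivity) (hγ t)
  · -- the shrunk curves avoid the unit circle, hence `F`
    intro n t ht
    have h1 : ‖shrink (1 - 1 / ((n : ℝ) + 2)) t‖ = 1 := by simpa using hF ht
    rw [shrink_apply, norm_mul, Complex.norm_real, Real.norm_eq_abs] at h1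
    have hpos : 0 < 1 / ((n : ℝ) + 2) := by positivity
    have hp1 : 1 / ((n : ℝ) + 2) ≤ 1 := by
      rw [div_le_one (by positivity)]
      linarith [n.cast_nonneg (α := ℝ)]
    rw [abs_of_nonneg (by linarith)] at h1
    have : (1 - 1 / ((n : ℝ) + 2)) * ‖γ t‖ ≤ (1 - 1 / ((n : ℝ) + 2)) * 1 :=
      mul_le_mul_of_nonneg_left (hγ t) (by linarith)
    linarith

/-! ### The repair: first-hitting parameters of the closed thickenings converge -/

/-- A larger target set is hit earlier. [folklore] -/
theorem hitParam_anti {E : Type*} [TopologicalSpace E] {F F' : Set E} (h : F' ⊆ F) (γ : Curve E) :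
    γ.hitParam F ≤ γ.hitParam F' := by
  refine csInf_le_csInf ⟨0, fun _ ht => (γ.hitSet_subset_Icc F ht).1⟩ ⟨1, γ.one_mem_hitSet F'⟩ ?_
  rintro t (⟨ht, hmem⟩ | ht)
  · exact Or.inl ⟨ht, h hmem⟩
  · exact Or.inr ht

/-- **REPAIR (deterministic).**  For a closed set `F` and EVERY curve `γ`, the first-hitting
parameter of the closed thickening `cthickening ε F` tends to that of `F` as `ε → 0` (along any
real sequence `εₙ → 0`; it is at most `hitParam F` since `F ⊆ cthickening εₙ F`, and any limit
point `t*` of a subsequence bounded away from `hitParam F` would satisfy `γ t* ∈ F` by closedness).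
So the lattice identities behind `IsLocal` / `IsTargetIndependent` / the Markov disintegration can
be passed to the limit at the FAT stopping sets `cthickening ε F` (entered, not only touched) and
then `ε ↓ 0` — instead of through the (unavailable) continuity of `stopAt F` itself. [folklore] -/
theorem tendsto_hitParam_cthickening {E : Type*} [PseudoEMetricSpace E] {F : Set E}
    (hF : IsClosed F) (γ : Curve E) {εs : ℕ → ℝ} (hε : Tendsto εs atTop (𝓝 0)) :
    Tendsto (fun n => γ.hitParam (Metric.cthickening (εs n) F)) atTop (𝓝 (γ.hitParam F)) := by
  set T := γ.hitParam F with hT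
  have hle : ∀ n, γ.hitParam (Metric.cthickening (εs n) F) ≤ T := fun n =>
    hitParam_anti (Metric.self_subset_cthickening F) γ
  rw [tendsto_order]
  refine ⟨fun a ha => ?_, fun a ha => Eventually.of_forall fun n => (hle n).trans_lt ha⟩
  -- lower bound: eventually `a < hitParam (cthickening (εs n) F)`
  by_contra hcon
  have hfreq : ∃ᶠ n in atTop, γ.hitParam (Metric.cthickening (εs n) F) ≤ a := by
    simpa only [not_eventually, not_lt] using hcon
  obtain ⟨φ, hφ, hφa⟩ := extraction_of_frequently_atTop hfreq
  -- the hitting parameters along `φ`, as points of `[0, 1]`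
  let t : ℕ → unitInterval := fun n =>
    ⟨γ.hitParam (Metric.cthickening (εs (φ n)) F), γ.hitParam_mem_Icc _⟩
  obtain ⟨tstar, -, ψ, hψ, hlim⟩ :=
    (isCompact_univ (X := unitInterval)).tendsto_subseq (x := t) fun _ => mem_univ _
  -- each thickening is met (its hitting parameter is `≤ a < T ≤ 1`), at the point `γ (t n)`
  have hmem : ∀ n, γ (t n) ∈ Metric.cthickening (εs (φ n)) F := by
    intro n
    apply Curve.apply_hitParam_mem Metric.isClosed_cthickening
    by_contra hno
    push Not at hno
    have h1 : γ.hitParam (Metric.cthickening (εs (φ n)) F) = 1 :=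
      Curve.hitParam_eq_one_of_forall_notMem hno
    have : T ≤ 1 := (γ.hitParam_mem_Icc F).2
    linarith [hφa n]
  -- the limit point `γ tstar` lies in `F`
  have hstar : γ tstar ∈ F := by
    rw [← hF.closure_eq, Metric.mem_closure_iff_infEDist_zero]
    refine le_antisymm ?_ bot_le
    have hcont : Tendsto (fun n => Metric.infEDist (γ (t (ψ n))) F) atTop
        (𝓝 (Metric.infEDist (γ tstar) F)) :=
      ((Metric.continuous_infEDist.comp γ.continuous).tendsto tstar).comp hlim
    have hbound : ∀ n, Metric.infEDist (γ (t (ψ n))) F ≤ ENNReal.ofReal (εs (φ (ψ n))) :=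
      fun n => Metric.mem_cthickening_iff.1 (hmem (ψ n))
    have hzero : Tendsto (fun n => ENNReal.ofReal (εs (φ (ψ n)))) atTop (𝓝 0) := by
      rw [← ENNReal.ofReal_zero]
      exact ENNReal.tendsto_ofReal ((hε.comp hφ.tendsto_atTop).comp hψ.tendsto_atTop)
    exact le_of_tendsto_of_tendsto hcont hzero (Eventually.of_forall hbound)
  -- hence `T ≤ tstar ≤ a < T`
  have hT_le : T ≤ (tstar : ℝ) := Curve.hitParam_le hstar
  have hts_le : (tstar : ℝ) ≤ a := by
    have hcoe : Tendsto (fun n => ((t (ψ n) : unitInterval) : ℝ)) atTop (𝓝 (tstar : ℝ)) :=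
      (continuous_subtype_val.tendsto tstar).comp hlim
    exact le_of_tendsto hcoe (Eventually.of_forall fun n => hφa (ψ n))
  linarith

end Summit.CriticalPhenomena.CardyFormulaZ2.Theorems.LagHandOff.Negative

end
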